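import Literature.NumberTheory.ComplexMultiplication.DegenerateOcticCMTypesSexticReflex
import HarnessLib

/-!
# Which octic CM fields carry degenerate simple CM abelian fourfolds: `K ⊇ D` imaginary quadratic and
# `3 ∣ [Kᶜ : ℚ]`; then the degenerate simple types are the types of weight `2` over `D` (Dodson 1984, §3.3.2)

B. Dodson, *The structure of Galois groups of CM-fields*, Trans. AMS **283** (1984) [Dodson1984] (held text
`paper:doi-10-2307-1999987`), §3.3.2 Theorem (p. 16): "Let `A` be a simple Abelian variety of CM-type `(K, Φ)`, with
`dim A = 4`.  Then `A` is degenerate if and only if `Gal(Kᶜ/ℚ) = ℤ₂ × A₄`, or `ℤ₂ × S₄` and `(K, Φ)` is the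
reflex of a type on a CM-field of degree `6`."  With §3.1.1 (pp. 11–12: a CM field with an imaginary quadratic
subfield `D` has "`Gal(Kᶜ/ℚ) = ⟨ρ⟩ × G₀`", `G₀ = Gal(Kᶜ/D) ≅ Gal(K₀ᶜ/ℚ)`, a type is "`Φ = Φᶠ, f ∈ (ℤ₂)ⁿ`" of
weight `|f|`, and "the `G`-orbit of `f` is `G₀*(f) ∪ G₀*(ρf)`") this says, for an octic CM field `K`:

**`K` is the CM field of a DEGENERATE SIMPLE CM abelian fourfold iff `K` contains an imaginary quadratic field
`D` and `3` divides `[Kᶜ : ℚ]` (i.e. `G₀ ∈ {A₄, S₄}`), and then the types of weight `2` over `D` (there are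
`C(4,2) = 6` of them) are degenerate and simple — each primitive, of rank `4`, with `6` Galois translates and sextic
reflex field.**

The sequel `DegenerateOcticCMTypesSexticReflex` proved the direction "degenerate simple ⟹" (`[K′ : ℚ] = 6`,
`|Gal(Kᶜ/ℚ)| ∈ {24, 48}`, `Gal(Kᶜ/ℚ) ≃ ℤ₂ × A₄` or `ℤ₂ × S₄`).  This file proves the converse direction and the
classification, classification-free (the print uses the `38` `ρ`-structures of §5.2):

* group level (`G` finite acting faithfully and transitively on `E`, `E₀` a `4`-element block, `3 ∣ |G|`; by the
  sequel the image of `G₀ = Stab(E₀)` in `Sym(E₀)` contains `A₄`, which is `2`-transitive — Mathlib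
  `alternatingGroup.isMultiplyPretransitive`): `IsCMTypeWith.exists_mem_stabilizer_smul_eq_of_block_four` (`G₀` is
  `2`-transitive on the block), **`IsCMTypeWith.card_orbit_eq_six_of_block_four`** (a type of weight `2` on the block
  has EXACTLY `6` translates), **`IsCMTypeWith.isPrimitive_of_block_four`** (it is primitive: its translates separate
  the embeddings), `IsCMTypeWith.typeRank_le_of_balanced_block` (rank `≤ |G • Φ|/2 + 1 ≤ C(n,n/2)/2 + 1`, any `n`);
* number fields (`K` CM of degree `8`, `L/ℚ` a Galois CM field receiving `K`, block `Φ₀` = a CM type of `K` with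
  quadratic reflex field, e.g. induced from an imaginary quadratic subfield): **`not_isNondegenerate_of_ncard_inter_eq_two`**
  (weight `2` over `D` ⟹ degenerate, for EVERY octic `K ⊇ D`), and for `L = Kᶜ` a normal closure with `3 ∣ [Kᶜ:ℚ]`:
  **`isPrimitive_of_ncard_inter_eq_two`** and `finrank_reflexField_eq_six_of_ncard_inter_eq_two` (weight `2` ⟹ primitive
  with sextic reflex field), `exists_cmType_ncard_inter_eq_two` (weight-`2` types exist), the type-level dichotomy
  `not_isNondegenerate_iff_exists_block_ncard_inter_eq_two` (primitive `Φ`: degenerate ⟺ weight `2` over SOME block), and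
  the classification **`exists_isPrimitive_not_isNondegenerate_iff`**: `K` has a primitive degenerate CM type ⟺
  (`K` has a CM type with quadratic reflex field) ∧ `3 ∣ [Kᶜ : ℚ]`; in subfield language
  **`exists_isPrimitive_not_isNondegenerate_iff_subfield`**: ⟺ (`K` has a quadratic subfield with a complex place) ∧
  `3 ∣ [Kᶜ : ℚ]`.

KERNEL ONLY: theorems, no definition, no named fact (D-0014/D-0026).  Count-neutral for COR-CM; `HC_CM` is neither
used nor mentioned.

## References

* [Dodson1984] B. Dodson, Trans. AMS 283 (1984) 1–32: §3.1.1 (pp. 11–12), §3.3.2 Theorem (pp. 16–17).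
* [MoonenZarhin1995Duke] B. Moonen, Yu. Zarhin, Duke Math. J. 77 (1995), Thm. 2.4; [Gordon1999HodgeAVSurvey] 5.13:
  a simple CM fourfold is degenerate iff an imaginary quadratic `k ⊆ K` acts with multiplicities `(2,2)`.
* [Shimura1998] G. Shimura, *Abelian varieties with complex multiplication and modular functions*, §8.2 Prop. 26,
  §32.10.
-/

set_option autoImplicit false

open scoped Pointwise

namespace Literature.NumberTheory.ComplexMultiplication

/-! ## Part I — group level -/

section GroupLevel

variable {G : Type*} [Group G] {E : Type*} [MulAction G E] {ρ : G} {Φ E₀ : Set E}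

namespace IsCMTypeWith

/-- **Rank bound for a type balanced over a block** (any block size `n`): `rank(Φ) ≤ |G • Φ|/2 + 1 ≤ C(n,a)/2 + 1`
with `a = |Φ ∩ E₀| = |E₀ ∖ Φ|` (Shimura §32.10 `r(φ) ≤ 1 + [K′:ℚ]/2` and "the `G`-orbit of `f` is
`G₀*(f) ∪ G₀*(ρf)`"). [cite: Dodson1984, §3.1.1 Theorem (proof)] [cite: Shimura1998, §32.10] -/
theorem typeRank_le_of_balanced_block [MulAction.IsPretransitive G E] [Finite E] (h : IsCMTypeWith ρ Φ)
    (h₀ : IsCMTypeWith ρ E₀) (hG : ∀ g : G, g • E₀ = E₀ ∨ g • E₀ = ρ • E₀)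
    (hbal : (Φ ∩ E₀).ncard = (E₀ \ Φ).ncard) (φh : E) :
    typeRank G Φ ≤ (E₀.ncard).choose (Φ ∩ E₀).ncard / 2 + 1 := by
  classical
  haveI : Fintype E := Fintype.ofFinite E
  have h1 := h.typeRank_le_card_orbit φh
  have h2 := h.card_orbit_le_choose h₀ hG hbal
  have h3 : Nat.card (MulAction.orbit G Φ) / 2 ≤ (E₀.ncard).choose (Φ ∩ E₀).ncard / 2 := Nat.div_le_div_right h2
  omega

/-- A block with `4` elements has a point other than two given ones. [folklore] -/
private theorem exists_mem_ne_ne [Finite E] (h4 : E₀.ncard = 4) (u v : E) : ∃ z ∈ E₀, z ≠ u ∧ z ≠ v := by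
  by_contra hno
  push Not at hno
  have hsub : E₀ ⊆ {u, v} := fun z hz => by
    by_cases hzu : z = u
    · exact Or.inl hzu
    · exact Or.inr (hno z hz hzu)
  have h1 := Set.ncard_le_ncard hsub (Set.toFinite _)
  have h2 : ({u, v} : Set E).ncard ≤ 2 := (Set.ncard_insert_le u {v}).trans (by rw [Set.ncard_singleton])
  omega

section BlockFour

variable [FaithfulSMul G E] [Finite E] [Finite G] [MulAction.IsPretransitive G E]

/-- **`G₀` is `2`-transitive on a `4`-element block when `3 ∣ |G|`**: its image in `Sym(E₀)` contains the
alternating group (sequel: `range_toPermHom_eq_of_block_four`), which is `2`-transitive on `4` letters.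
[cite: Dodson1984, §3.3.2 Theorem] -/
theorem exists_mem_stabilizer_smul_eq_of_block_four (h₀ : IsCMTypeWith ρ E₀)
    (hG : ∀ g : G, g • E₀ = E₀ ∨ g • E₀ = ρ • E₀) (h4 : E₀.ncard = 4) (h3 : 3 ∣ Nat.card G)
    {a b c d : E} (ha : a ∈ E₀) (hb : b ∈ E₀) (hc : c ∈ E₀) (hd : d ∈ E₀) (hab : a ≠ b) (hcd : c ≠ d) :
    ∃ m ∈ MulAction.stabilizer G E₀, m • a = c ∧ m • b = d := by
  classical
  letI : Fintype E₀ := Fintype.ofFinite E₀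
  have hA : alternatingGroup E₀ ≤ (MulAction.toPermHom (MulAction.stabilizer G E₀) E₀).range := by
    rcases h₀.range_toPermHom_eq_of_block_four hG h4 h3 with h | h
    · exact le_of_eq h.symm
    · rw [h]; exact le_top
  have h2t : MulAction.IsMultiplyPretransitive (alternatingGroup E₀) E₀ 2 := by
    have := alternatingGroup.isMultiplyPretransitive E₀
    rwa [show Nat.card E₀ - 2 = 2 by rw [Nat.card_coe_set_eq, h4]] at this
  have hab' : (⟨a, ha⟩ : E₀) ≠ ⟨b, hb⟩ := fun h => hab (congrArg Subtype.val h)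
  have hcd' : (⟨c, hc⟩ : E₀) ≠ ⟨d, hd⟩ := fun h => hcd (congrArg Subtype.val h)
  obtain ⟨σ, hσa, hσb⟩ := (MulAction.is_two_pretransitive_iff.1 h2t) hab' hcd'
  obtain ⟨m, hm⟩ := hA σ.2
  have hσ : ∀ (x : E₀), ((m : G) • (x : E)) = ((σ • x : E₀) : E) := fun x => by
    have h1 : (MulAction.toPermHom (MulAction.stabilizer G E₀) E₀ m) x = (σ : Equiv.Perm E₀) x := by rw [hm]
    have h2 := congrArg Subtype.val h1
    rw [MulAction.toPermHom_apply, MulAction.toPerm_apply, SMul.smul_stabilizer_def] at h2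
    exact h2
  refine ⟨(m : G), m.2, ?_, ?_⟩
  · rw [hσ ⟨a, ha⟩, hσa]
  · rw [hσ ⟨b, hb⟩, hσb]

/-- Hence `G₀` moves any `2`-subset of the block to any other. [cite: Dodson1984, §3.3.2 Theorem] -/
theorem exists_mem_stabilizer_smul_set_eq_of_block_four (h₀ : IsCMTypeWith ρ E₀)
    (hG : ∀ g : G, g • E₀ = E₀ ∨ g • E₀ = ρ • E₀) (h4 : E₀.ncard = 4) (h3 : 3 ∣ Nat.card G)
    {T T' : Set E} (hT : T ⊆ E₀) (hT2 : T.ncard = 2) (hT' : T' ⊆ E₀) (hT'2 : T'.ncard = 2) :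
    ∃ m ∈ MulAction.stabilizer G E₀, m • T = T' := by
  obtain ⟨a, b, hab, rfl⟩ := Set.ncard_eq_two.1 hT2
  obtain ⟨c, d, hcd, rfl⟩ := Set.ncard_eq_two.1 hT'2
  obtain ⟨m, hm, hma, hmb⟩ := h₀.exists_mem_stabilizer_smul_eq_of_block_four hG h4 h3
    (hT (by simp)) (hT (by simp)) (hT' (by simp)) (hT' (by simp)) hab hcd
  exact ⟨m, hm, by rw [Set.smul_set_insert, Set.smul_set_singleton, hma, hmb]⟩

/-- Every `2`-subset of the block is the trace of a translate of a weight-`2` type.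
[cite: Dodson1984, §3.3.2 Theorem; §3.1.1 Theorem (proof)] -/
theorem exists_smul_set_inter_eq_of_block_four (h₀ : IsCMTypeWith ρ E₀)
    (hG : ∀ g : G, g • E₀ = E₀ ∨ g • E₀ = ρ • E₀) (h4 : E₀.ncard = 4) (h3 : 3 ∣ Nat.card G)
    (h2 : (Φ ∩ E₀).ncard = 2) {T : Set E} (hT : T ⊆ E₀) (hT2 : T.ncard = 2) :
    ∃ m ∈ MulAction.stabilizer G E₀, m • Φ ∩ E₀ = T := by
  obtain ⟨m, hm, hmT⟩ := h₀.exists_mem_stabilizer_smul_set_eq_of_block_four hG h4 h3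
    Set.inter_subset_right h2 hT hT2
  refine ⟨m, hm, ?_⟩
  have hmE : m • E₀ = E₀ := hm
  rw [← hmT, Set.smul_set_inter, hmE]

/-- **A type of weight `2` on a `4`-element block has EXACTLY `6` translates** when `3 ∣ |G|` (at most `C(4,2) = 6`
by "`G₀*(f) ∪ G₀*(ρf)`", and every `2`-subset of the block occurs as a trace).
[cite: Dodson1984, §3.3.2 Theorem; §3.1.1 Theorem (proof)] -/
theorem card_orbit_eq_six_of_block_four (h : IsCMTypeWith ρ Φ) (h₀ : IsCMTypeWith ρ E₀)
    (hG : ∀ g : G, g • E₀ = E₀ ∨ g • E₀ = ρ • E₀) (h4 : E₀.ncard = 4) (h3 : 3 ∣ Nat.card G)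
    (h2 : (Φ ∩ E₀).ncard = 2) : Nat.card (MulAction.orbit G Φ) = 6 := by
  classical
  have hbal : (Φ ∩ E₀).ncard = (E₀ \ Φ).ncard := by
    have := Set.ncard_inter_add_ncard_sdiff_eq_ncard E₀ Φ (Set.toFinite E₀)
    rw [Set.inter_comm] at this
    omega
  refine le_antisymm ?_ ?_
  · have := h.card_orbit_le_choose h₀ hG hbal
    rw [h4, h2] at this
    exact this.trans (by decide)
  · -- surject the orbit onto the `2`-subsets of a finset copy of the block
    obtain ⟨E₀f, hE₀f⟩ := (Set.toFinite E₀).exists_finset_coe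
    have hcard6 : Nat.card (E₀f.powersetCard 2) = 6 := by
      rw [Nat.card_eq_fintype_card, Fintype.card_coe, Finset.card_powersetCard, ← Set.ncard_coe_finset, hE₀f,
        h4]
      decide
    have htrace : ∀ Ψ : Set E, ((E₀f.filter fun x => x ∈ Ψ : Finset E) : Set E) = Ψ ∩ E₀ := fun Ψ => by
      ext x
      rw [Finset.coe_filter, Set.mem_setOf_eq, ← Finset.mem_coe, hE₀f, Set.mem_inter_iff, and_comm]
    have hmem : ∀ Ψ : MulAction.orbit G Φ, (E₀f.filter fun x => x ∈ (Ψ : Set E)) ∈ E₀f.powersetCard 2 := by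
      rintro ⟨Ψ, g, rfl⟩
      rw [Finset.mem_powersetCard]
      refine ⟨Finset.filter_subset _ _, ?_⟩
      rw [← Set.ncard_coe_finset, htrace]
      rcases h.ncard_smul_set_inter_eq_or h₀ hG g with h1 | h1
      · rw [h1, h2]
      · rw [h1, ← hbal, h2]
    let f : MulAction.orbit G Φ → E₀f.powersetCard 2 := fun Ψ => ⟨_, hmem Ψ⟩
    have hf : Function.Surjective f := by
      rintro ⟨T, hT⟩
      have hT' := Finset.mem_powersetCard.1 hT
      have hTs : ((T : Set E)) ⊆ E₀ := by rw [← hE₀f]; exact Finset.coe_subset.2 hT'.1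
      have hT2 : (T : Set E).ncard = 2 := by rw [Set.ncard_coe_finset, hT'.2]
      obtain ⟨m, -, hm⟩ := h₀.exists_smul_set_inter_eq_of_block_four hG h4 h3 h2 hTs hT2
      refine ⟨⟨m • Φ, MulAction.mem_orbit Φ m⟩, Subtype.ext ?_⟩
      apply Finset.coe_injective
      change ((E₀f.filter fun x => x ∈ m • Φ : Finset E) : Set E) = T
      rw [htrace, hm]
    calc 6 = Nat.card (E₀f.powersetCard 2) := hcard6.symm
      _ ≤ Nat.card (MulAction.orbit G Φ) := Nat.card_le_card_of_surjective f hf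

/-- **A type of weight `2` on a `4`-element block is PRIMITIVE** when `3 ∣ |G|`: its translates separate the points of
`E` (Shimura's criterion, tree `isPrimitive_iff_forall_eq`), because every `2`-subset of the block is a trace.
[cite: Dodson1984, §3.3.2 Theorem] [cite: Shimura1998, §8.2 Prop. 26] -/
theorem isPrimitive_of_block_four (h : IsCMTypeWith ρ Φ) (h₀ : IsCMTypeWith ρ E₀)
    (hG : ∀ g : G, g • E₀ = E₀ ∨ g • E₀ = ρ • E₀) (h4 : E₀.ncard = 4) (h3 : 3 ∣ Nat.card G)
    (h2 : (Φ ∩ E₀).ncard = 2) (φh : E) : IsPrimitive G Φ φh := by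
  classical
  rw [isPrimitive_iff_forall_eq]
  -- a translate whose trace on the block is a prescribed pair `{u, v}`
  have key : ∀ u v : E, u ∈ E₀ → v ∈ E₀ → u ≠ v →
      ∃ g : G, ∀ w ∈ E₀, (g • w ∈ Φ ↔ w = u ∨ w = v) := by
    intro u v hu hv huv
    obtain ⟨m, -, hm⟩ := h₀.exists_smul_set_inter_eq_of_block_four hG h4 h3 h2 (T := {u, v})
      (by intro w hw; rcases hw with rfl | rfl; exacts [hu, hv]) (Set.ncard_pair huv)
    refine ⟨m⁻¹, fun w hw => ?_⟩
    have : w ∈ m • Φ ∩ E₀ ↔ w ∈ ({u, v} : Set E) := by rw [hm]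
    rw [Set.mem_inter_iff, Set.mem_smul_set_iff_inv_smul_mem, Set.mem_insert_iff, Set.mem_singleton_iff] at this
    exact ⟨fun h1 => this.1 ⟨h1, hw⟩, fun h1 => (this.2 h1).1⟩
  -- outside the block, membership of `g • y` is the negation of membership of `g • ρy`
  have flip : ∀ (g : G) (y : E), g • y ∈ Φ ↔ g • ρ • y ∉ Φ := fun g y => by
    rw [h.comm]; exact h.mem_iff (g • y)
  -- the mixed case: `x ∈ E₀`, `y ∉ E₀`
  have mixed : ∀ x y : E, x ∈ E₀ → y ∉ E₀ → (∀ g : G, g • x ∈ Φ ↔ g • y ∈ Φ) → False := by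
    intro x y hx hy hxy
    have hρy : ρ • y ∈ E₀ := (h₀.rho_smul_mem_iff y).2 hy
    by_cases hρyx : ρ • y = x
    · have h1 := hxy 1
      rw [one_smul, one_smul] at h1
      have h2 := flip 1 y
      rw [one_smul, one_smul, hρyx] at h2
      -- `h1 : x ∈ Φ ↔ y ∈ Φ`, `h2 : y ∈ Φ ↔ x ∉ Φ`
      by_cases hxΦ : x ∈ Φ
      · exact (h2.1 (h1.1 hxΦ)) hxΦ
      · exact hxΦ (h1.2 (h2.2 hxΦ))
    · obtain ⟨g, hg⟩ := key x (ρ • y) hx hρy (Ne.symm hρyx)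
      have hgx : g • x ∈ Φ := (hg x hx).2 (Or.inl rfl)
      have hgρy : g • ρ • y ∈ Φ := (hg (ρ • y) hρy).2 (Or.inr rfl)
      exact ((flip g y).1 ((hxy g).1 hgx)) hgρy
  intro x y hxy
  by_contra hne
  by_cases hx : x ∈ E₀ <;> by_cases hy : y ∈ E₀
  · -- both in the block: a trace containing `x` and avoiding `y`
    obtain ⟨z, hz, hzx, hzy⟩ := exists_mem_ne_ne (E₀ := E₀) h4 x y
    obtain ⟨g, hg⟩ := key x z hx hz (Ne.symm hzx)
    have hgy : g • y ∈ Φ := (hxy g).1 ((hg x hx).2 (Or.inl rfl))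
    rcases (hg y hy).1 hgy with h1 | h1
    · exact hne h1.symm
    · exact hzy h1.symm
  · exact mixed x y hx hy hxy
  · exact mixed y x hy hx fun g => (hxy g).symm
  · -- both outside: `ρx, ρy ∈ E₀`, distinct
    have hρx : ρ • x ∈ E₀ := (h₀.rho_smul_mem_iff x).2 hx
    have hρy : ρ • y ∈ E₀ := (h₀.rho_smul_mem_iff y).2 hy
    have hρne : ρ • x ≠ ρ • y := fun h1 => hne (by simpa only [h₀.invol] using congrArg (fun w => ρ • w) h1)
    obtain ⟨z, hz, hzx, hzy⟩ := exists_mem_ne_ne (E₀ := E₀) h4 (ρ • x) (ρ • y)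
    obtain ⟨g, hg⟩ := key (ρ • y) z hρy hz (Ne.symm hzy)
    -- `g ρx ∉ Φ` (trace is `{ρy, z}`), so `g x ∈ Φ`, so `g y ∈ Φ`, so `g ρy ∉ Φ` — but `ρy` is in the trace
    have hgρx : g • ρ • x ∉ Φ := fun h1 => by
      rcases (hg (ρ • x) hρx).1 h1 with h2 | h2
      · exact hρne h2
      · exact hzx h2.symm
    have hgx : g • x ∈ Φ := (flip g x).2 hgρx
    have hgy : g • y ∈ Φ := (hxy g).1 hgx
    exact ((flip g y).1 hgy) ((hg (ρ • y) hρy).2 (Or.inl rfl))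

end BlockFour

end IsCMTypeWith

end GroupLevel

/-! ## Part II — octic CM fields -/

section Octic

open NumberField IntermediateField
open Literature.AlgebraicGeometry.Motives (CMType)
open Literature.AlgebraicGeometry.Pohlmann1968

variable {K : Type} [Field K] [NumberField K]
variable {L : Type} [Field L] [NumberField L] [IsCMField L] [IsGalois ℚ L]

/-- An (imaginary) quadratic number field with one non-real embedding is totally complex. [folklore] -/
private theorem isTotallyComplex_of_conjugate_ne' {k : Type*} [Field k] [NumberField k]
    (hk : Module.finrank ℚ k = 2) {τ₀ : k →+* ℂ} (hτ₀ : ComplexEmbedding.conjugate τ₀ ≠ τ₀) :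
    IsTotallyComplex k := by
  classical
  have hcard : Fintype.card (k →+* ℂ) = 2 := by rw [Embeddings.card, hk]
  have huniv : ({τ₀, ComplexEmbedding.conjugate τ₀} : Finset (k →+* ℂ)) = Finset.univ :=
    Finset.eq_univ_of_card _ (by rw [Finset.card_pair hτ₀.symm, hcard])
  refine ⟨fun v => ?_⟩
  rw [← InfinitePlace.not_isReal_iff_isComplex, InfinitePlace.isReal_iff]
  intro hreal
  have hmem : v.embedding ∈ ({τ₀, ComplexEmbedding.conjugate τ₀} : Finset (k →+* ℂ)) := by
    rw [huniv]; exact Finset.mem_univ _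
  simp only [Finset.mem_insert, Finset.mem_singleton] at hmem
  have hfix : ComplexEmbedding.conjugate v.embedding = v.embedding := hreal
  have hcc : ComplexEmbedding.conjugate (ComplexEmbedding.conjugate τ₀) = τ₀ := star_star τ₀
  rcases hmem with h1 | h1
  · exact hτ₀ (by rw [← h1]; exact hfix)
  · rw [h1, hcc] at hfix
    exact hτ₀ hfix.symm

omit [IsCMField L] [IsGalois ℚ L] in
/-- `algValuedIn` commutes with `∩`. [folklore] -/
private theorem algValuedIn_inter' (ι : L →+* ℂ) (Ψ Ψ' : Set (K →+* ℂ)) :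
    algValuedIn ι (Ψ ∩ Ψ') = algValuedIn ι Ψ ∩ algValuedIn ι Ψ' := rfl

/-- **Weight `2` over an imaginary quadratic subfield forces degeneracy** (every octic `K ⊇ D`): a CM type `Φ` with
`|Φ ∩ Φ₀| = 2` for a block `Φ₀` (a CM type with quadratic reflex field) has `[K′(Φ) : ℚ] ≤ C(4,2) = 6 < 8 = [K : ℚ]`,
so it is degenerate by Kubota's necessary condition. [cite: Dodson1984, §3.3.2 Theorem; §3.1.0 (p. 11)] -/
theorem not_isNondegenerate_of_ncard_inter_eq_two (hK : Module.finrank ℚ K = 8) (j : K →ₐ[ℚ] L) (ι : L →+* ℂ)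
    (Φ₀ Φ : CMType K) (h2q : Module.finrank ℚ (reflexField ℚ L (algValuedIn ι Φ₀.1)) = 2)
    (h2 : (Φ.1 ∩ Φ₀.1).ncard = 2) : ¬ IsNondegenerate Φ := by
  have hbal : (Φ.1 ∩ Φ₀.1).ncard = (Φ₀.1 \ Φ.1).ncard := by
    have := Set.ncard_inter_add_ncard_sdiff_eq_ncard Φ₀.1 Φ.1 (Set.toFinite _)
    rw [Set.inter_comm, ncard_cmType_eq, hK] at this
    omega
  have hle := finrank_reflexField_le_choose j ι Φ₀ Φ h2q hbal
  rw [hK, h2] at hle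
  exact not_isNondegenerate_of_finrank_reflexField_lt hK j ι Φ (lt_of_le_of_lt hle (by decide))

/-- The rank of such a type is at most `4`. [cite: Dodson1984, §3.3.2 Theorem] [cite: Shimura1998, §32.10] -/
theorem cmTypeRank_le_four_of_ncard_inter_eq_two (hK : Module.finrank ℚ K = 8) (j : K →ₐ[ℚ] L) (ι : L →+* ℂ)
    (Φ₀ Φ : CMType K) (h2q : Module.finrank ℚ (reflexField ℚ L (algValuedIn ι Φ₀.1)) = 2)
    (h2 : (Φ.1 ∩ Φ₀.1).ncard = 2) : cmTypeRank Φ ≤ 4 := by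
  classical
  have hbal : (Φ.1 ∩ Φ₀.1).ncard = (Φ₀.1 \ Φ.1).ncard := by
    have := Set.ncard_inter_add_ncard_sdiff_eq_ncard Φ₀.1 Φ.1 (Set.toFinite _)
    rw [Set.inter_comm, ncard_cmType_eq, hK] at this
    omega
  have hle := finrank_reflexField_le_choose j ι Φ₀ Φ h2q hbal
  rw [hK, h2, finrank_reflexField_eq_card_orbit] at hle
  have hW := isCMTypeWith_conjGal_algValuedIn ι Φ
  have hr := hW.typeRank_le_card_orbit j
  rw [typeRank_algValuedIn_eq_cmTypeRank j ι Φ] at hr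
  have : Nat.card (MulAction.orbit (L ≃ₐ[ℚ] L) (algValuedIn ι Φ.1)) ≤ 6 := hle.trans (by decide)
  omega

/-- **Weight `2` over `D` with `3 ∣ [Kᶜ : ℚ]` gives EXACTLY `6` translates, i.e. a SEXTIC reflex field** (`L = Kᶜ` a
normal closure). [cite: Dodson1984, §3.3.2 Theorem] -/
theorem finrank_reflexField_eq_six_of_ncard_inter_eq_two [IsNormalClosure ℚ K L] (hK : Module.finrank ℚ K = 8)
    (j : K →ₐ[ℚ] L) (ι : L →+* ℂ) (Φ₀ Φ : CMType K)
    (h2q : Module.finrank ℚ (reflexField ℚ L (algValuedIn ι Φ₀.1)) = 2) (h2 : (Φ.1 ∩ Φ₀.1).ncard = 2)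
    (h3 : 3 ∣ Module.finrank ℚ L) : Module.finrank ℚ (reflexField ℚ L (algValuedIn ι Φ.1)) = 6 := by
  have h₀ := isCMTypeWith_conjGal_algValuedIn ι Φ₀
  have h := isCMTypeWith_conjGal_algValuedIn ι Φ
  have hG := smul_algValuedIn_eq_or_of_finrank_reflexField_eq_two j ι Φ₀ h2q
  have h4 : (algValuedIn ι Φ₀.1).ncard = 4 := by rw [ncard_algValuedIn j ι, ncard_cmType_eq, hK]
  have h2' : (algValuedIn ι Φ.1 ∩ algValuedIn ι Φ₀.1).ncard = 2 := by
    rw [← algValuedIn_inter', ncard_algValuedIn j ι, h2]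
  have h3' : 3 ∣ Nat.card (L ≃ₐ[ℚ] L) := by rwa [IsGalois.card_aut_eq_finrank]
  rw [finrank_reflexField_eq_card_orbit]
  exact h.card_orbit_eq_six_of_block_four h₀ hG h4 h3' h2'

/-- **Weight `2` over `D` with `3 ∣ [Kᶜ : ℚ]` gives a PRIMITIVE type** (a simple CM abelian fourfold, Shimura §8.2
Prop. 26). [cite: Dodson1984, §3.3.2 Theorem] [cite: Shimura1998, §8.2 Prop. 26] -/
theorem isPrimitive_of_ncard_inter_eq_two [IsNormalClosure ℚ K L] (hK : Module.finrank ℚ K = 8)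
    (j : K →ₐ[ℚ] L) (ι : L →+* ℂ) (Φ₀ Φ : CMType K)
    (h2q : Module.finrank ℚ (reflexField ℚ L (algValuedIn ι Φ₀.1)) = 2) (h2 : (Φ.1 ∩ Φ₀.1).ncard = 2)
    (h3 : 3 ∣ Module.finrank ℚ L) (φ₀ : K →+* ℂ) : IsPrimitive (ℂ ≃+* ℂ) Φ.1 φ₀ := by
  have h₀ := isCMTypeWith_conjGal_algValuedIn ι Φ₀
  have h := isCMTypeWith_conjGal_algValuedIn ι Φ
  have hG := smul_algValuedIn_eq_or_of_finrank_reflexField_eq_two j ι Φ₀ h2q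
  have h4 : (algValuedIn ι Φ₀.1).ncard = 4 := by rw [ncard_algValuedIn j ι, ncard_cmType_eq, hK]
  have h2' : (algValuedIn ι Φ.1 ∩ algValuedIn ι Φ₀.1).ncard = 2 := by
    rw [← algValuedIn_inter', ncard_algValuedIn j ι, h2]
  have h3' : 3 ∣ Nat.card (L ≃ₐ[ℚ] L) := by rwa [IsGalois.card_aut_eq_finrank]
  exact (isPrimitive_algValuedIn_iff j ι Φ.1 j φ₀).1 (h.isPrimitive_of_block_four h₀ hG h4 h3' h2' j)

omit [NumberField K] in
/-- **Weight-`2` types exist**: for every block `Φ₀` of an octic field (indeed for any `2`-subset `S` of it) there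
is a CM type `Φ` with `Φ ∩ Φ₀ = S` — "the type `Φᶠ`" with `f = Φ₀ ∖ S`. [cite: Dodson1984, §1.2 Proposition] -/
theorem exists_cmType_inter_eq (Φ₀ : CMType K) {S : Set (K →+* ℂ)} (hS : S ⊆ Φ₀.1) :
    ∃ Φ : CMType K, Φ.1 ∩ Φ₀.1 = S := by
  classical
  refine ⟨⟨{φ | (φ ∈ Φ₀.1 ∧ φ ∈ S) ∨ (φ ∉ Φ₀.1 ∧ ComplexEmbedding.conjugate φ ∉ S)}, fun φ => ?_⟩, ?_⟩
  · have hcc : ComplexEmbedding.conjugate (ComplexEmbedding.conjugate φ) = φ := star_star φ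
    simp only [Set.mem_setOf_eq, hcc]
    by_cases hφ : φ ∈ Φ₀.1
    · have hcφ : ComplexEmbedding.conjugate φ ∉ Φ₀.1 := (Φ₀.2 φ).1 hφ
      constructor
      · rintro (⟨-, hφS⟩ | ⟨hφ', -⟩)
        · rintro (⟨h1, -⟩ | ⟨-, h2⟩)
          · exact hcφ h1
          · exact h2 hφS
        · exact absurd hφ hφ'
      · intro hno
        left
        refine ⟨hφ, ?_⟩
        by_contra hφS
        exact hno (Or.inr ⟨hcφ, hφS⟩)
    · have hcφ : ComplexEmbedding.conjugate φ ∈ Φ₀.1 := by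
        by_contra h1
        exact hφ ((Φ₀.2 φ).2 h1)
      constructor
      · rintro (⟨hφ', -⟩ | ⟨-, hcS⟩)
        · exact absurd hφ' hφ
        · rintro (⟨-, h2⟩ | ⟨h1, -⟩)
          · exact hcS h2
          · exact h1 hcφ
      · intro hno
        right
        refine ⟨hφ, fun hcS => hno (Or.inl ⟨hcφ, hcS⟩)⟩
  · ext φ
    simp only [Set.mem_inter_iff, Set.mem_setOf_eq]
    constructor
    · rintro ⟨(⟨-, h1⟩ | ⟨h1, -⟩), h2⟩
      · exact h1
      · exact absurd h2 h1
    · intro hφS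
      exact ⟨Or.inl ⟨hS hφS, hφS⟩, hS hφS⟩

/-- In particular an octic field with a block has a CM type of weight `2` over it. [cite: Dodson1984, §3.3.2 Theorem] -/
theorem exists_cmType_ncard_inter_eq_two (hK : Module.finrank ℚ K = 8) (Φ₀ : CMType K) :
    ∃ Φ : CMType K, (Φ.1 ∩ Φ₀.1).ncard = 2 := by
  have h4 : Φ₀.1.ncard = 4 := by rw [ncard_cmType_eq, hK]
  obtain ⟨a, b, ha, hb, hab⟩ := (Set.one_lt_ncard_iff (Set.toFinite Φ₀.1)).1 (by rw [h4]; norm_num)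
  obtain ⟨Φ, hΦ⟩ := exists_cmType_inter_eq Φ₀ (S := {a, b})
    (by intro φ hφ; rcases hφ with rfl | rfl; exacts [ha, hb])
  exact ⟨Φ, by rw [hΦ, Set.ncard_pair hab]⟩

variable [IsCMField K]

/-- **The degenerate simple types are the weight-`2` types**: for a PRIMITIVE CM type `Φ` of an octic CM field,
`Φ` is degenerate iff `|Φ ∩ Φ₀| = 2` for SOME block `Φ₀` (a CM type with quadratic reflex field — the type of an
imaginary quadratic subfield acting with multiplicities `(2,2)`). [cite: Dodson1984, §3.3.2 Theorem]
[cite: MoonenZarhin1995Duke, Thm. 2.4] -/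
theorem not_isNondegenerate_iff_exists_block_ncard_inter_eq_two (hK : Module.finrank ℚ K = 8) (j : K →ₐ[ℚ] L)
    (ι : L →+* ℂ) (Φ : CMType K) (φ₀ : K →+* ℂ) (hprim : IsPrimitive (ℂ ≃+* ℂ) Φ.1 φ₀) :
    ¬ IsNondegenerate Φ ↔ ∃ Φ₀ : CMType K,
      Module.finrank ℚ (reflexField ℚ L (algValuedIn ι Φ₀.1)) = 2 ∧ (Φ.1 ∩ Φ₀.1).ncard = 2 := by
  constructor
  · intro hdeg
    have h := (isNondegenerate_iff_forall_not_weilFibre hK φ₀ hprim).not.1 hdeg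
    push Not at h
    obtain ⟨k, hk2, τ₀, hτ₀, hW⟩ := h
    haveI : IsTotallyComplex k := isTotallyComplex_of_conjugate_ne' hk2 hτ₀
    refine ⟨inducedCMType (algebraMap k K : k →+* K) (CMTypeCount.single hk2 τ₀),
      finrank_reflexField_algValuedIn_inducedCMType_single hk2 _ j ι τ₀, ?_⟩
    -- the weight: the fibre has `[K : k] = 4` elements, half of them in `Φ`
    classical
    have hfib : (Finset.univ.filter fun φ : K →+* ℂ => φ.comp (algebraMap k K) = τ₀).card = 4 := by
      rw [card_fibre_eq_finrank (K := K) τ₀]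
      have hmul := Module.finrank_mul_finrank ℚ k K
      rw [hk2, hK] at hmul
      omega
    have ha : {φ : K →+* ℂ | φ.comp (algebraMap k K) = τ₀ ∧ φ ∈ Φ.1}.ncard = 2 := by
      have h2 := card_fibre_eq_two_mul (algebraMap k K : k →+* K) hW τ₀
      rw [hfib] at h2
      omega
    have hset : Φ.1 ∩ (inducedCMType (algebraMap k K : k →+* K) (CMTypeCount.single hk2 τ₀)).1 =
        {φ : K →+* ℂ | φ.comp (algebraMap k K) = τ₀ ∧ φ ∈ Φ.1} := by
      ext φ
      simp only [Set.mem_inter_iff, mem_inducedCMType_iff, CMTypeCount.single_val, Set.mem_singleton_iff,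
        Set.mem_setOf_eq]
      tauto
    rw [hset, ha]
  · rintro ⟨Φ₀, h2q, h2⟩
    exact not_isNondegenerate_of_ncard_inter_eq_two hK j ι Φ₀ Φ h2q h2

/-- **Classification of the octic CM fields with degenerate simple CM abelian fourfolds** (`L = Kᶜ` a normal
closure): `K` has a PRIMITIVE DEGENERATE CM type iff `K` has a block (a CM type with quadratic reflex field — an
imaginary quadratic subfield) and `3 ∣ [Kᶜ : ℚ]` ("`Gal(Kᶜ/ℚ) = ℤ₂ × A₄`, or `ℤ₂ × S₄`").
[cite: Dodson1984, §3.3.2 Theorem] -/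
theorem exists_isPrimitive_not_isNondegenerate_iff [IsNormalClosure ℚ K L] (hK : Module.finrank ℚ K = 8)
    (j : K →ₐ[ℚ] L) (ι : L →+* ℂ) (φ₀ : K →+* ℂ) :
    (∃ Φ : CMType K, IsPrimitive (ℂ ≃+* ℂ) Φ.1 φ₀ ∧ ¬ IsNondegenerate Φ) ↔
      (∃ Φ₀ : CMType K, Module.finrank ℚ (reflexField ℚ L (algValuedIn ι Φ₀.1)) = 2) ∧
        3 ∣ Module.finrank ℚ L := by
  constructor
  · rintro ⟨Φ, hprim, hdeg⟩
    obtain ⟨Φ₀, h2q, -⟩ := (not_isNondegenerate_iff_exists_block_ncard_inter_eq_two hK j ι Φ φ₀ hprim).1 hdeg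
    refine ⟨⟨Φ₀, h2q⟩, ?_⟩
    rw [← IsGalois.card_aut_eq_finrank]
    exact three_dvd_card_gal_of_not_isNondegenerate hK j ι Φ φ₀ hprim hdeg
  · rintro ⟨⟨Φ₀, h2q⟩, h3⟩
    obtain ⟨Φ, h2⟩ := exists_cmType_ncard_inter_eq_two hK Φ₀
    exact ⟨Φ, isPrimitive_of_ncard_inter_eq_two hK j ι Φ₀ Φ h2q h2 h3 φ₀,
      not_isNondegenerate_of_ncard_inter_eq_two hK j ι Φ₀ Φ h2q h2⟩

/-- **The same classification in subfield language**: an octic CM field `K` has a primitive degenerate CM type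
(carries a DEGENERATE SIMPLE CM abelian fourfold) iff `K` has a quadratic subfield with a complex place (an imaginary
quadratic subfield) and `3 ∣ [Kᶜ : ℚ]`. [cite: Dodson1984, §3.3.2 Theorem] [cite: MoonenZarhin1995Duke, Thm. 2.4] -/
theorem exists_isPrimitive_not_isNondegenerate_iff_subfield [IsNormalClosure ℚ K L] (hK : Module.finrank ℚ K = 8)
    (j : K →ₐ[ℚ] L) (ι : L →+* ℂ) (φ₀ : K →+* ℂ) :
    (∃ Φ : CMType K, IsPrimitive (ℂ ≃+* ℂ) Φ.1 φ₀ ∧ ¬ IsNondegenerate Φ) ↔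
      (∃ k : IntermediateField ℚ K, Module.finrank ℚ k = 2 ∧
          ∃ τ₀ : k →+* ℂ, ComplexEmbedding.conjugate τ₀ ≠ τ₀) ∧ 3 ∣ Module.finrank ℚ L := by
  constructor
  · rintro ⟨Φ, hprim, hdeg⟩
    have h := (isNondegenerate_iff_forall_not_weilFibre hK φ₀ hprim).not.1 hdeg
    push Not at h
    obtain ⟨k, hk2, τ₀, hτ₀, -⟩ := h
    refine ⟨⟨k, hk2, τ₀, hτ₀⟩, ?_⟩
    rw [← IsGalois.card_aut_eq_finrank]
    exact three_dvd_card_gal_of_not_isNondegenerate hK j ι Φ φ₀ hprim hdeg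
  · rintro ⟨⟨k, hk2, τ₀, hτ₀⟩, h3⟩
    haveI : IsTotallyComplex k := isTotallyComplex_of_conjugate_ne' hk2 hτ₀
    exact (exists_isPrimitive_not_isNondegenerate_iff hK j ι φ₀).2
      ⟨⟨_, finrank_reflexField_algValuedIn_inducedCMType_single hk2 (algebraMap k K : k →+* K) j ι τ₀⟩, h3⟩

end Octic

end Literature.NumberTheory.ComplexMultiplication
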